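import Literature.AlgebraicGeometry.HodgeTheory.SupportedClassesPurity
import Literature.AlgebraicGeometry.HodgeTheory.ThomGysinClosedImmersion
import Literature.AlgebraicTopology.SingularHomology.PoincareDualityProofs
import Literature.AlgebraicTopology.SingularHomology.SubsetCochainsComparisonPull
import Literature.AlgebraicTopology.SingularHomology.GysinMapSupportProofs
import Literature.AlgebraicTopology.SingularHomology.FundamentalClassExistence
import Literature.AlgebraicGeometry.Motives.ComplexPointsOrientation
import Summits.HodgeConjecture.HodgeConjecture.Theorems.AmpleAdicLefschetzAlgebraicClassesHodgeTypeCyclic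

/-!
# Route AmpleAdicLefschetz — `AlgebraicClassesHodgeType`, part 3: Deligne's Prop. 8.2.7 in top
# degree for one irreducible subvariety, from a bump class (Čech–Alexander duality)

Helper file for item stmt-HodgeConjecture-15189 (`AlgebraicClassesHodgeType`).  For `X` smooth
projective of dimension `n` over `ℂ`, `V ⊆ X` closed irreducible with every point of codimension
`≥ p ≥ 1`, `T = V(ℂ)`, and `g : Y ⟶ X` from a smooth projective `Y` of dimension `d = n - p` with
`g(Y(ℂ)) ⊆ T`, SUPPOSE some class `η ∈ H^{2d}(W₁; ℂ)` on an open `W₁ ⊇ T` has `g(ℂ)^* η ≠ 0` in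
`H^{2d}(Y(ℂ); ℂ)` (part 2 supplies it for a resolution).  Then (`exists_isOpen_map_subsetIncl_eq_zero_of_bump`)
every `x' ∈ H^{2d}(X(ℂ); ℂ)` with `g(ℂ)^* x' = 0` vanishes on an open neighbourhood of `T` — the
hypothesis `H` of the tree's `ker_restrictCompl_le_iSup_range_complexGysin_of_pullback`
(`HodgeTheory/ThomGysinClosedImmersion`: Deligne, Hodge III, Prop. 8.2.7 read in Čech form) in the
top degree `q = 2d`, where no mixed Hodge theory is needed.

Proof: the Čech cohomology `Ȟ^{2d}(T; ℂ) = colim_{W ⊇ T} H^{2d}_X(W)` (`Cech`, Miller Def. 34.4) is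
isomorphic, by Čech–Alexander–Poincaré duality along the closed subset `T` of the closed oriented
manifold `X(ℂ)` (`HomologicalOrientation.cechDuality_res`, Miller Thm. 37.1), to the local homology
`H_{2p}(X(ℂ) | T; ℂ)`, which is at most a line (part 1,
`exists_forall_eq_smul_clocalHomology_setOf_pt_mem`); the pull-back `g(ℂ)^*` is defined on Čech
classes (`subsetCochains.pullH`, compatible with restriction) and does not kill the germ of `η`,
so that germ spans `Ȟ^{2d}(T)` and `g(ℂ)^*` is one-to-one on it; the germ of `x'` is killed, hence
vanishes, i.e. `x'` dies on some open `W ⊇ T` (`Cech.of_eq_zero_iff`,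
`subsetCochains.resH_thetaInv_eq_zero_iff`).  Everything here is proved; no definitions, no named
facts.
-/

set_option linter.dupNamespace false

noncomputable section

open CategoryTheory CategoryTheory.Limits AlgebraicGeometry Set TopologicalSpace
open Literature.AlgebraicGeometry Literature.AlgebraicGeometry.HodgeTheory
open Literature.AlgebraicTopology.SingularHomology

namespace Summit.HodgeConjecture.HodgeConjecture.Theorems

variable {n : ℕ} {X : Motives.SchemeOver ℂ}

/-- **Top-degree Prop. 8.2.7 in Čech form, from a bump class.** Let `X` be smooth projective of
dimension `n`, `V ⊆ X` closed irreducible with every point of codimension `≥ p`, `p ≥ 1`,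
`g : Y ⟶ X` a morphism from a smooth projective `Y` of dimension `d = n - p` with `g(Y(ℂ)) ⊆ V(ℂ)`,
and suppose some class `η ∈ H^{2d}(W₁; ℂ)` on an open neighbourhood `W₁ ⊇ V(ℂ)` has
`g(ℂ)^* η ≠ 0` in `H^{2d}(Y(ℂ); ℂ)`. Then every `x' ∈ H^{2d}(X(ℂ); ℂ)` with `g(ℂ)^* x' = 0`
vanishes on an open neighbourhood of `V(ℂ)`. Proof: by Čech–Alexander duality along `V(ℂ)`
(`HomologicalOrientation.cechDuality_res`) the Čech cohomology `Ȟ^{2d}(V(ℂ); ℂ)` is isomorphic to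
`H_{2p}(X(ℂ) | V(ℂ); ℂ)`, a line (`exists_forall_eq_smul_clocalHomology_setOf_pt_mem`); the pull-back
`g(ℂ)^*` is defined on it and does not vanish on the germ of `η`, hence is one-to-one; the germ of
`x'` is killed, hence is zero. [cite: DeligneHodgeIII1974, Prop. 8.2.7] [cite: Miller2020, Thm. 37.1] -/
theorem exists_isOpen_map_subsetIncl_eq_zero_of_bump (hX : Motives.IsSmoothProjective n X)
    {V : Set X.left} (hV : IsClosed V) (hVi : IsIrreducible V) {p : ℕ} (hp : 1 ≤ p)
    (hpV : ∀ v ∈ V, (p : ℕ∞) ≤ Order.coheight v) {d : ℕ} {Y : Motives.SchemeOver ℂ} (g : Y ⟶ X)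
    (hpd : p + d = n) {W₁ : Set (Motives.ComplexPoints X)} (hW₁ : IsOpen W₁)
    (hVW₁ : {P : Motives.ComplexPoints X | P.pt ∈ V} ⊆ W₁)
    (hgV : ∀ z : Motives.ComplexPoints Y, (Motives.AlgPoints.mapContinuous (L := ℂ) g z).pt ∈ V)
    (hgW₁ : MapsTo (Motives.AlgPoints.mapContinuous (L := ℂ) g) univ W₁)
    (η : singularCohomology ℂ ℂ ↥W₁ (2 * d))
    (hη : singularCohomology.map ℂ ℂ
      (subsetCochains.restrictMap (Motives.AlgPoints.mapContinuous (L := ℂ) g) hgW₁) (2 * d) η ≠ 0)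
    (x' : complexBetti X (2 * d)) (hx' : complexBetti.map g (2 * d) x' = 0) :
    ∃ W : Set (Motives.ComplexPoints X), IsOpen W ∧ {P : Motives.ComplexPoints X | P.pt ∈ V} ⊆ W ∧
      singularCohomology.map ℂ ℂ (subsetIncl W) (2 * d) x' = 0 := by
  -- the closed manifold `M = X(ℂ)` and the closed subset `T = V(ℂ)`
  letI := hX.chartedSpace
  haveI := Motives.ComplexPoints.compactSpace_of_isSmoothProjective hX
  haveI := Motives.ComplexPoints.t2Space_of_isSmoothProjective hX
  set T : Set (Motives.ComplexPoints X) := {P | P.pt ∈ V} with hTdef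
  have hT : IsClosed T := isClosed_setOf_pt_mem hV
  set gc : C(Motives.ComplexPoints Y, Motives.ComplexPoints X) :=
    Motives.AlgPoints.mapContinuous (L := ℂ) g with hgc
  -- Čech–Alexander duality along `T` for the fundamental class of `M`
  obtain ⟨μ⟩ := Motives.ComplexPoints.isOrientableOver ℂ hX
  set γ₀ : clocalHomology ℂ ℂ (Motives.ComplexPoints X) (univ : Set (Motives.ComplexPoints X)) (2 * n) :=
    (relativeSingularHomology.concreteIso ℂ ℂ (Motives.ComplexPoints X)
      (univ : Set (Motives.ComplexPoints X))ᶜ (2 * n)).hom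
      (relativeSingularHomology.ofAbsolute ℂ ℂ (Motives.ComplexPoints X)
        (univ : Set (Motives.ComplexPoints X))ᶜ (2 * n) μ.fundamentalClass)
    with hγ₀
  have hγ := HomologicalOrientation.res_fundamentalClass_point μ
  have hdeg : 2 * d + 2 * p = 2 * n := by omega
  have hD : Function.Bijective (cechCap hT hdeg
      (clocalHomology.res ℂ ℂ (Motives.ComplexPoints X) (Set.subset_univ T) (2 * n) γ₀)) :=
    HomologicalOrientation.cechDuality_res μ hγ hT (2 * d) (2 * p) hdeg
  -- so the Čech cohomology `Ȟ^{2d}(T)` is at most a line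
  have hcyc : ∃ c₀ : Cech ℂ (SimplexSpan.coefR ℂ) T (2 * d), ∀ c, ∃ t : ℂ, c = t • c₀ :=
    exists_forall_eq_smul_of_injective _ hD.1
      (exists_forall_eq_smul_clocalHomology_setOf_pt_mem hX hV hVi hp hpV)
  obtain ⟨c₀, hc₀⟩ := hcyc
  -- the two neighbourhoods `X(ℂ) ⊇ W₁ ⊇ T` and the two classes, in the model `H^*_M(–)`
  let U₁ : OpenNhd (Motives.ComplexPoints X) T := ⟨W₁, hW₁, hVW₁⟩
  let U₀ : OpenNhd (Motives.ComplexPoints X) T := OpenNhd.univ T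
  have h01 : U₀ ≤ U₁ := Set.subset_univ _
  set ηm : (subsetCochains ℂ (SimplexSpan.coefR ℂ) W₁).homology (2 * d) :=
    (subsetCochains.homologyIsoSingularCohomology ℂ W₁ (2 * d)).inv η with hηm
  set xm := subsetCochains.thetaInv (R := ℂ) (X := Motives.ComplexPoints X) (2 * d) x' with hxm
  -- pull-backs to `N = Y(ℂ)` along `g(ℂ)`, which lands in `T`
  have hgU : ∀ U : OpenNhd (Motives.ComplexPoints X) T,
      MapsTo gc (univ : Set (Motives.ComplexPoints Y)) U.carrier :=
    fun U z _ ↦ U.subset (hgV z)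
  have key_res : ∀ (U U' : OpenNhd (Motives.ComplexPoints X) T) (hle : U' ≤ U)
      (y : (subsetCochains ℂ (SimplexSpan.coefR ℂ) U'.carrier).homology (2 * d)),
      subsetCochains.pullH (N := SimplexSpan.coefR ℂ) gc (hgU U) (2 * d)
          (subsetCochains.resH hle (2 * d) y) =
        subsetCochains.pullH (N := SimplexSpan.coefR ℂ) gc (hgU U') (2 * d) y := by
    intro U U' hle y
    have h := subsetCochains.resH_comp_pullH (N := SimplexSpan.coefR ℂ) gc
      (subset_refl (univ : Set (Motives.ComplexPoints Y))) hle (hgU U') (hgU U) (2 * d)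
    have h' := congrArg (fun φ ↦ φ y) h
    simp only [ModuleCat.comp_apply] at h'
    rw [h']
    change (HomologicalComplex.homologyMap (subsetCochains.res ℂ (SimplexSpan.coefR ℂ)
      (subset_refl (univ : Set (Motives.ComplexPoints Y)))) (2 * d)) _ = _
    rw [subsetCochains.res_refl, HomologicalComplex.homologyMap_id]
    rfl
  have key_η : (subsetCochains.homologyIsoSingularCohomology ℂ
      (univ : Set (Motives.ComplexPoints Y)) (2 * d)).hom
      (subsetCochains.pullH (N := SimplexSpan.coefR ℂ) gc hgW₁ (2 * d) ηm) =
      singularCohomology.map ℂ ℂ (subsetCochains.restrictMap gc hgW₁) (2 * d) η := by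
    rw [subsetCochains.homologyIsoSingularCohomology_hom_pullH, hηm, Iso.inv_hom_id_apply]
  have hpull_ne : subsetCochains.pullH (N := SimplexSpan.coefR ℂ) gc hgW₁ (2 * d) ηm ≠ 0 := by
    intro h0
    apply hη
    rw [← key_η, h0, map_zero]
  have hgU₀ : MapsTo gc (univ : Set (Motives.ComplexPoints Y)) (univ : Set (Motives.ComplexPoints X)) :=
    hgU U₀
  have key_x : subsetCochains.pullH (N := SimplexSpan.coefR ℂ) gc hgU₀ (2 * d) xm = 0 := by
    apply (subsetCochains.homologyIsoSingularCohomology ℂ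
      (univ : Set (Motives.ComplexPoints Y)) (2 * d)).toLinearEquiv.injective
    rw [map_zero]
    change (subsetCochains.homologyIsoSingularCohomology ℂ (univ : Set (Motives.ComplexPoints Y))
      (2 * d)).hom (subsetCochains.pullH (N := SimplexSpan.coefR ℂ) gc hgU₀ (2 * d) xm) = 0
    rw [subsetCochains.homologyIsoSingularCohomology_hom_pullH, hxm,
      subsetCochains.homologyIsoSingularCohomology_hom_thetaInv, ← ModuleCat.comp_apply,
      ← singularCohomology.map_comp]
    change singularCohomology.map ℂ ℂ
      (gc.comp (⟨Subtype.val, continuous_subtype_val⟩ :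
        C(↥(univ : Set (Motives.ComplexPoints Y)), Motives.ComplexPoints Y))) (2 * d) x' = 0
    rw [singularCohomology.map_comp, ModuleCat.comp_apply]
    change singularCohomology.map ℂ ℂ _ (2 * d) (complexBetti.map g (2 * d) x') = 0
    rw [hx', map_zero]
  -- the Čech classes `c₁ = [η]`, `cx = [x']` along `T`; `c₁ ≠ 0` since `g(ℂ)^* η ≠ 0`
  set c₁ := Cech.of ℂ (SimplexSpan.coefR ℂ) U₁ ηm with hc₁
  set cx := Cech.of ℂ (SimplexSpan.coefR ℂ) U₀ xm with hcx
  have hc₁ne : c₁ ≠ 0 := by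
    intro h0
    obtain ⟨U, hle, hres⟩ := (Cech.of_eq_zero_iff _).1 h0
    apply hpull_ne
    rw [← key_res U U₁ hle ηm, hres, map_zero]
  obtain ⟨s, hs⟩ := hc₀ c₁
  obtain ⟨r, hr⟩ := hc₀ cx
  have hs0 : s ≠ 0 := by
    rintro rfl
    rw [zero_smul] at hs
    exact hc₁ne hs
  have hcx_eq : cx = (r / s) • c₁ := by rw [hs, smul_smul, div_mul_cancel₀ r hs0, hr]
  -- compare representatives on a common neighbourhood and pull back to `N`
  have hcx' : cx = Cech.of ℂ (SimplexSpan.coefR ℂ) U₁ (subsetCochains.resH h01 (2 * d) xm) :=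
    (Cech.of_res h01 xm).symm
  rw [hcx', hc₁, ← map_smul] at hcx_eq
  obtain ⟨U, hle, hUeq⟩ := (Cech.of_eq_of_iff _ _).1 hcx_eq
  rw [map_smul] at hUeq
  have h2 := congrArg (subsetCochains.pullH (N := SimplexSpan.coefR ℂ) gc (hgU U) (2 * d)) hUeq
  rw [map_smul, key_res U U₁ hle (subsetCochains.resH h01 (2 * d) xm), key_res U₁ U₀ h01 xm,
    key_res U U₁ hle ηm] at h2
  rw [show subsetCochains.pullH (N := SimplexSpan.coefR ℂ) gc (hgU U₀) (2 * d) xm = 0 from key_x]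
    at h2
  have hrs : r / s = 0 := by
    rcases smul_eq_zero.1 h2.symm with h | h
    · exact h
    · exact absurd h hpull_ne
  have hr0 : r = 0 := by
    rcases div_eq_zero_iff.1 hrs with h | h
    · exact h
    · exact absurd h hs0
  -- so the germ of `x'` along `T` vanishes
  have hcx0 : Cech.of ℂ (SimplexSpan.coefR ℂ) U₀ xm = 0 := by
    rw [← hcx, hr, hr0, zero_smul]
  obtain ⟨W, hW, hres0⟩ := (Cech.of_eq_zero_iff _).1 hcx0
  exact ⟨W.carrier, W.isOpen, W.subset,
    (subsetCochains.resH_thetaInv_eq_zero_iff W.carrier (2 * d) x').1 hres0⟩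

end Summit.HodgeConjecture.HodgeConjecture.Theorems

end
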